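import Literature.Probability.RandomPlanarGeometry.SAWTriangularPolygonGadgets
import HarnessLib

/-!
# The eight gadgets and the insertion step on `𝕋` («TRI-SAP-RATIO-RATE», G2ʷ — part 3 of 4)

Topic `Literature/Probability/RandomPlanarGeometry` (lane «pcv-sawmu», routes R82/R83). Source: N. Madras, G. Slade,
*The Self-Avoiding Walk* (1993), §3.2, proof of Theorem 3.2.3 (concatenation of polygons), insertion input of
Theorem 7.4.5 (c) p. 254. The book exchanges two parallel edges of `ℤ^d`; on `𝕋` we use an explicit table of EIGHT
gadgets (orientation at the anchor × anchor edge East/South × corner edge horizontal/North-West), each removing one walk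
edge and one polygon edge and adding six edges through provably free sites, so the output length is `n + m + 4`
uniformly (stem `k = 4`).

* cyclic neighbours `cnext`, `cprev`, `adj_cnext`, `adj_cprev`, **`exists_polyPath_ends`** (both traversals of the
  polygon minus the corner edge are `polyPath`s);
* **`exists_orientation`** (one walk edge at an interior top-left vertex goes E or S), **`exists_corner`** (the
  polygon has an edge from its bottom-left vertex to `q+(1,0)` or to `q+(-1,1)`);
* the table **`gad : Bool → Bool → Bool → Gadget`**, **`gad_valid`** (all eight valid, by `decide`), its projections;
* **`insertion_of_gadget`**, **`exists_insertion`**: for `ω ∈ S_n(𝕋)` with interior top-left vertex and a rooted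
  polygon `lam ∈ loopSL (m-1)` (`m ≥ 3`) there are `s < n`, `c`, `r₀ < m`, `d₀` and a block `Λ` of length `m + 4` with
  `splice s Λ ω ∈ S_{n+m+4}(𝕋)` and `polyDecode (pathOf c m Λ) r₀ d₀ = lam` (the pair is recoverable).
-/

noncomputable section

open Finset Literature.Probability.LatticeModels Literature.Probability.Percolation SimpleGraph
open scoped BigOperators

namespace Literature.Probability.RandomPlanarGeometry.SAW

namespace PolygonInsertion

variable {n m j r : ℕ} {ω lam : List (Site 2)}

/-! ### Cyclic neighbours on the polygon and the two ends of the inserted path -/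

/-- Cyclic successor in `ℤ/m`. [cite: MadrasSlade1993, §3.2 (concatenation of polygons; bookkeeping)] -/
def cnext (m i : ℕ) : ℕ := if i + 1 < m then i + 1 else 0

/-- Cyclic predecessor in `ℤ/m`. [cite: MadrasSlade1993, §3.2 (concatenation of polygons; bookkeeping)] -/
def cprev (m i : ℕ) : ℕ := if 0 < i then i - 1 else m - 1

/-- Bookkeeping (`cnext_lt`). [cite: MadrasSlade1993, §3.2 (concatenation of polygons; bookkeeping)] -/
theorem cnext_lt (hm : 0 < m) (i : ℕ) : cnext m i < m := by unfold cnext; split_ifs <;> omega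
/-- Bookkeeping (`cprev_lt`). [cite: MadrasSlade1993, §3.2 (concatenation of polygons; bookkeeping)] -/
theorem cprev_lt (hm : 0 < m) {i : ℕ} (hi : i < m) : cprev m i < m := by unfold cprev; split_ifs <;> omega
/-- Bookkeeping (`cprev_cnext`). [cite: MadrasSlade1993, §3.2 (concatenation of polygons; bookkeeping)] -/
theorem cprev_cnext (hr : r < m) : cprev m (cnext m r) = r := by unfold cprev cnext; split_ifs <;> omega
/-- Bookkeeping (`cnext_cprev`). [cite: MadrasSlade1993, §3.2 (concatenation of polygons; bookkeeping)] -/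
theorem cnext_cprev (hr : r < m) : cnext m (cprev m r) = r := by unfold cprev cnext; split_ifs <;> omega
/-- Bookkeeping (`cnext_ne_cprev`). [cite: MadrasSlade1993, §3.2 (concatenation of polygons; bookkeeping)] -/
theorem cnext_ne_cprev (hm : 3 ≤ m) (hr : r < m) : cnext m r ≠ cprev m r := by
  unfold cprev cnext; split_ifs <;> omega
/-- Bookkeeping (`rot_false_last`). [cite: MadrasSlade1993, §3.2 (concatenation of polygons; bookkeeping)] -/
theorem rot_false_last (hr : r < m) : rot m r false (m - 1) = cnext m r := by
  unfold rot cnext; simp only [Bool.false_eq_true, ↓reduceIte]; split_ifs <;> omega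
/-- Bookkeeping (`rot_true_last`). [cite: MadrasSlade1993, §3.2 (concatenation of polygons; bookkeeping)] -/
theorem rot_true_last (hr : r < m) : rot m r true (m - 1) = cprev m r := by
  unfold rot cprev; simp only [↓reduceIte]; split_ifs <;> omega

/-- Consecutive polygon vertices (cyclically) are adjacent. [cite: MadrasSlade1993, §3.2] -/
theorem adj_cnext {M : ℕ} (hlam : lam ∈ loopSL M) {i : ℕ} (hi : i < M + 1) :
    triGraph.Adj (lam.getD i 0) (lam.getD (cnext (M + 1) i) 0) := by
  have hS := (mem_loopSL.1 hlam).1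
  unfold cnext; split_ifs with h
  · exact adj_getD_of_mem_triSL hS (by omega)
  · rw [show i = M by omega, getD_zero_of_mem_triSL hS]; exact (mem_loopSL.1 hlam).2

/-- Consecutive polygon vertices (cyclically) are adjacent. [cite: MadrasSlade1993, §3.2] -/
theorem adj_cprev {M : ℕ} (hlam : lam ∈ loopSL M) {i : ℕ} (hi : i < M + 1) :
    triGraph.Adj (lam.getD i 0) (lam.getD (cprev (M + 1) i) 0) := by
  have h := adj_cnext hlam (cprev_lt (by omega) hi)
  rw [cnext_cprev hi] at h
  exact h.symm

/-- **Both traversals of the polygon minus one edge are available as `polyPath`s.** [cite: MadrasSlade1993, §3.2] -/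
theorem exists_polyPath_ends (hlm : lam.length = m) (hr : r < m) {e : ℕ} (he : e = cnext m r ∨ e = cprev m r)
    (τ : Site 2) :
    (∃ r₀ < m, ∃ d : Bool, (polyPath lam τ r₀ d).head? = some (lam.getD r 0 + τ) ∧
      (polyPath lam τ r₀ d).getLast? = some (lam.getD e 0 + τ)) ∧
    (∃ r₀ < m, ∃ d : Bool, (polyPath lam τ r₀ d).head? = some (lam.getD e 0 + τ) ∧
      (polyPath lam τ r₀ d).getLast? = some (lam.getD r 0 + τ)) := by
  have hm : 0 < m := by omega
  have H0 : ∀ r₀ < m, (polyPath lam τ r₀ false).head? = some (lam.getD r₀ 0 + τ) ∧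
      (polyPath lam τ r₀ false).getLast? = some (lam.getD (cnext m r₀) 0 + τ) := fun r₀ hr₀ =>
    ⟨head?_polyPath false (by omega), by rw [getLast?_polyPath false (by omega), hlm, rot_false_last hr₀]⟩
  have H1 : ∀ r₀ < m, (polyPath lam τ r₀ true).head? = some (lam.getD r₀ 0 + τ) ∧
      (polyPath lam τ r₀ true).getLast? = some (lam.getD (cprev m r₀) 0 + τ) := fun r₀ hr₀ =>
    ⟨head?_polyPath true (by omega), by rw [getLast?_polyPath true (by omega), hlm, rot_true_last hr₀]⟩
  rcases he with rfl | rfl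
  · refine ⟨⟨r, hr, false, H0 r hr⟩, ⟨cnext m r, cnext_lt hm r, true, ?_⟩⟩
    have h := H1 (cnext m r) (cnext_lt hm r)
    rwa [cprev_cnext hr] at h
  · refine ⟨⟨r, hr, true, H1 r hr⟩, ⟨cprev m r, cprev_lt hm hr, false, ?_⟩⟩
    have h := H0 (cprev m r) (cprev_lt hm hr)
    rwa [cnext_cprev hr] at h

/-! ### Reading off the orientation at the walk anchor and the corner type of the polygon -/

/-- Offset of the walk vertex before the block (`o = true`: the block enters `p` from behind). [cite: MadrasSlade1993, §3.2 (concatenation of polygons; bookkeeping)] -/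
def stOff (o pS : Bool) : ℤ × ℤ := if o then (if pS then (0, -1) else (1, 0)) else (0, 0)

/-- Offset of the walk vertex after the block. [cite: MadrasSlade1993, §3.2 (concatenation of polygons; bookkeeping)] -/
def enOff (o pS : Bool) : ℤ × ℤ := if o then (0, 0) else (if pS then (0, -1) else (1, 0))

/-- **Orientation at the anchor.** One of the two walk edges at an interior top-left vertex `p` goes East or South;
the block is spliced across it. [cite: MadrasSlade1993, §3.2] -/
theorem exists_orientation (hω : ω ∈ triSL n) (hT : IsTopLeft ω n j) (h0 : 0 < j) (hj : j < n) :
    ∃ (o pS : Bool) (s : ℕ), s < n ∧ ω.getD s 0 = pt (ω.getD j 0) (stOff o pS).1 (stOff o pS).2 ∧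
      ω.getD (s + 1) 0 = pt (ω.getD j 0) (enOff o pS).1 (enOff o pS).2 := by
  have hf := hT.nbr_cases (i := j + 1) (by omega) (adj_getD_of_mem_triSL hω (by omega))
  have hb' := adj_getD_of_mem_triSL hω (i := j - 1) (by omega)
  rw [show j - 1 + 1 = j by omega] at hb'
  have hb := hT.nbr_cases (i := j - 1) (by omega) hb'.symm
  have hne : ω.getD (j - 1) 0 ≠ ω.getD (j + 1) 0 := fun e => by
    have := getD_injOn_of_mem_triSL hω (by omega) (by omega) e; omega
  have hp : ω.getD j 0 = pt (ω.getD j 0) 0 0 := (pt_zero_zero _).symm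
  rcases hf with hf | hf | hf
  · exact ⟨false, false, j, hj, hp, hf⟩
  · exact ⟨false, true, j, hj, hp, hf⟩
  rcases hb with hb | hb | hb
  · exact ⟨true, false, j - 1, by omega, hb, by rw [show j - 1 + 1 = j by omega]; exact hp⟩
  · exact ⟨true, true, j - 1, by omega, hb, by rw [show j - 1 + 1 = j by omega]; exact hp⟩
  · exact absurd (hb.trans hf.symm) hne

/-- Column offset (from `p`) of the translated bottom-left polygon vertex: `-1` for a horizontal corner edge, `0` for
the North-West corner edge. [cite: MadrasSlade1993, §3.2 (concatenation of polygons; bookkeeping)] -/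
def qaOf (qV : Bool) : ℤ := if qV then 0 else -1

/-- Offset (from the bottom-left vertex `q`) of the far end of the removed polygon edge. [cite: MadrasSlade1993, §3.2 (concatenation of polygons; bookkeeping)] -/
def bOff (qV : Bool) : ℤ × ℤ := if qV then (-1, 1) else (1, 0)

/-- **Corner type of the polygon.** At its bottom-left vertex `q` a polygon with `m ≥ 3` vertices has an edge to
`q + (1, 0)` or an edge to `q + (-1, 1)`. [cite: MadrasSlade1993, §3.2] -/
theorem exists_corner (hlam : lam ∈ loopSL (m - 1)) (hm : 3 ≤ m) (hB : IsBotLeft lam m r) :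
    ∃ (qV : Bool) (e : ℕ), (e = cnext m r ∨ e = cprev m r) ∧
      lam.getD e 0 = pt (lam.getD r 0) (bOff qV).1 (bOff qV).2 := by
  have hr := hB.lt
  have hM : m - 1 + 1 = m := by omega
  have h1 := adj_cnext hlam (i := r) (by omega)
  have h2 := adj_cprev hlam (i := r) (by omega)
  rw [hM] at h1 h2
  have hn := hB.nbr_cases (cnext_lt (by omega) r) h1
  have hp := hB.nbr_cases (cprev_lt (by omega) hr) h2
  have hne : lam.getD (cnext m r) 0 ≠ lam.getD (cprev m r) 0 := fun e =>
    cnext_ne_cprev hm hr (getD_injOn_of_mem_triSL (mem_loopSL.1 hlam).1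
      (by have := cnext_lt (by omega : 0 < m) r; omega) (by have := cprev_lt (by omega : 0 < m) hr; omega) e)
  rcases hn with hn | hn | hn
  · exact ⟨false, _, Or.inl rfl, hn⟩
  rotate_left
  · exact ⟨true, _, Or.inl rfl, hn⟩
  rcases hp with hp | hp | hp
  · exact ⟨false, _, Or.inr rfl, hp⟩
  · exact absurd (hn.trans hp.symm) hne
  · exact ⟨true, _, Or.inr rfl, hp⟩

/-! ### The eight gadgets -/

/-- The gadget table: orientation `o`, anchor edge type `pS` (South; else East), corner type `qV` (North-West; else
horizontal). Each removes one walk edge and one polygon edge and adds six edges through free sites, so the output has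
`n + m + 4` edges uniformly. [cite: MadrasSlade1993, §3.2 (concatenation of polygons)] -/
def gad : Bool → Bool → Bool → Gadget
  | false, false, false => ⟨[(0, 1), (-1, 1), (-2, 2)], (-1, 2), (0, 2), [(1, 1)], (0, 0), (1, 0), -1⟩
  | true, false, false => ⟨[(1, 1)], (0, 2), (-1, 2), [(-2, 2), (-1, 1), (0, 1)], (1, 0), (0, 0), -1⟩
  | false, false, true => ⟨[(0, 1), (-1, 1), (-1, 2)], (-1, 3), (0, 2), [(1, 1)], (0, 0), (1, 0), 0⟩
  | true, false, true => ⟨[(1, 1)], (0, 2), (-1, 3), [(-1, 2), (-1, 1), (0, 1)], (1, 0), (0, 0), 0⟩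
  | false, true, false => ⟨[(0, 1)], (0, 2), (-1, 2), [(-2, 2), (-1, 1), (-1, 0)], (0, 0), (0, -1), -1⟩
  | true, true, false => ⟨[(-1, 0), (-1, 1), (-2, 2)], (-1, 2), (0, 2), [(0, 1)], (0, -1), (0, 0), -1⟩
  | false, true, true => ⟨[(0, 1)], (0, 2), (-1, 3), [(-1, 2), (-1, 1), (-1, 0)], (0, 0), (0, -1), 0⟩
  | true, true, true => ⟨[(-1, 0), (-1, 1), (-1, 2)], (-1, 3), (0, 2), [(0, 1)], (0, -1), (0, 0), 0⟩

/-- **All eight gadgets are valid** (a finite check). [cite: MadrasSlade1993, §3.2] -/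
theorem gad_valid (o pS qV : Bool) : (gad o pS qV).Valid := by
  cases o <;> cases pS <;> cases qV <;> decide

/-- Bookkeeping (`gad_st`). [cite: MadrasSlade1993, §3.2 (concatenation of polygons; bookkeeping)] -/
theorem gad_st (o pS qV : Bool) : (gad o pS qV).st = stOff o pS := by
  cases o <;> cases pS <;> cases qV <;> rfl

/-- Bookkeeping (`gad_en`). [cite: MadrasSlade1993, §3.2 (concatenation of polygons; bookkeeping)] -/
theorem gad_en (o pS qV : Bool) : (gad o pS qV).en = enOff o pS := by
  cases o <;> cases pS <;> cases qV <;> rfl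

/-- Bookkeeping (`gad_qa`). [cite: MadrasSlade1993, §3.2 (concatenation of polygons; bookkeeping)] -/
theorem gad_qa (o pS qV : Bool) : (gad o pS qV).qa = qaOf qV := by
  cases o <;> cases pS <;> cases qV <;> rfl

/-- Bookkeeping (`gad_c1`). [cite: MadrasSlade1993, §3.2 (concatenation of polygons; bookkeeping)] -/
theorem gad_c1 (o pS qV : Bool) : (gad o pS qV).c1.length = 3 ∨ (gad o pS qV).c1.length = 1 := by
  cases o <;> cases pS <;> cases qV <;> decide

/-- Bookkeeping (`gad_uv`). [cite: MadrasSlade1993, §3.2 (concatenation of polygons; bookkeeping)] -/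
theorem gad_uv (o pS qV : Bool) :
    ((gad o pS qV).u = (qaOf qV, 2) ∧ (gad o pS qV).v = (qaOf qV + (bOff qV).1, 2 + (bOff qV).2)) ∨
    ((gad o pS qV).u = (qaOf qV + (bOff qV).1, 2 + (bOff qV).2) ∧ (gad o pS qV).v = (qaOf qV, 2)) := by
  cases o <;> cases pS <;> cases qV <;> decide

/-! ### The insertion -/

/-- Decoding the block: strip the first connector (of length `3` or `1`) and keep `m` sites. [cite: MadrasSlade1993, §3.2 (concatenation of polygons; bookkeeping)] -/
def pathOf (c : Bool) (m : ℕ) (Λ : List (Site 2)) : List (Site 2) := (Λ.drop (if c then 3 else 1)).take m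

/-- Bookkeeping (`pathOf_block`). [cite: MadrasSlade1993, §3.2 (concatenation of polygons; bookkeeping)] -/
theorem pathOf_block (g : Gadget) (hc : g.c1.length = 3 ∨ g.c1.length = 1) (p : Site 2) (P : List (Site 2)) :
    pathOf (decide (g.c1.length = 3)) P.length (g.block p P) = P := by
  have h : (if decide (g.c1.length = 3) then 3 else 1) = (g.c1.map fun c => pt p c.1 c.2).length := by
    rw [List.length_map]; rcases hc with h | h <;> simp [h]
  rw [pathOf, h, Gadget.block, List.append_assoc, List.drop_left, List.take_left]

/-- **One insertion step** for a fixed valid gadget. [cite: MadrasSlade1993, §3.2 (concatenation of polygons)] -/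
theorem insertion_of_gadget (g : Gadget) (hg : g.Valid) (hc1 : g.c1.length = 3 ∨ g.c1.length = 1) {s : ℕ}
    (hω : ω ∈ triSL n) (hT : IsTopLeft ω n j) (hsN : s + 1 ≤ n)
    (hst : ω.getD s 0 = pt (ω.getD j 0) g.st.1 g.st.2) (hen : ω.getD (s + 1) 0 = pt (ω.getD j 0) g.en.1 g.en.2)
    (hlam : lam ∈ loopSL (m - 1)) (hlm : lam.length = m) (hB : IsBotLeft lam m r) {τ : Site 2}
    (hτ : lam.getD r 0 + τ = pt (ω.getD j 0) g.qa 2) {r₀ : ℕ} (hr₀ : r₀ < m) {d₀ : Bool}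
    (hPu : (polyPath lam τ r₀ d₀).head? = some (pt (ω.getD j 0) g.u.1 g.u.2))
    (hPv : (polyPath lam τ r₀ d₀).getLast? = some (pt (ω.getD j 0) g.v.1 g.v.2)) :
    ∃ (c : Bool) (r₀ : ℕ) (d₀ : Bool) (Λ : List (Site 2)), r₀ < m ∧ Λ.length = m + 4 ∧
      splice s Λ ω ∈ triSL (n + (m + 4)) ∧ polyDecode (pathOf c m Λ) r₀ d₀ = lam := by
  have hS := (mem_loopSL.1 hlam).1
  have hPl : (polyPath lam τ r₀ d₀).length = m := by rw [length_polyPath, hlm]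
  refine ⟨decide (g.c1.length = 3), r₀, d₀, g.block (ω.getD j 0) (polyPath lam τ r₀ d₀), hr₀, ?_, ?_, ?_⟩
  · simp only [Gadget.block, List.length_append, List.length_map, hPl]; have := hg.2.2.1; omega
  · rw [← hPl]
    refine g.splice_block_mem hg hω hT hsN hst hen (polyPath_isChain hlam τ d₀ (by omega))
      (polyPath_nodup hlam τ d₀ (by omega)) hPu hPv fun x hx => ?_
    have h := hB.mem_polyPath hlm τ hr₀ d₀ hx
    rw [hτ] at h
    simpa only [pt_apply_one, pt_apply_zero] using h
  · rw [← hPl, pathOf_block g hc1]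
    exact polyDecode_polyPath d₀ (by omega) (getD_zero_of_mem_triSL hS)

/-- **The insertion (frame `b`).** A walk `ω ∈ S_n(𝕋)` whose top-left vertex is interior and a rooted polygon with
`m ≥ 3` vertices splice into a walk of `S_{n+m+4}(𝕋)` from which `(ω, λ)` is recovered given the splice position
`s < n`, one bit (connector length), the root position `r₀ < m` and one orientation bit.
[cite: MadrasSlade1993, §3.2 (concatenation of polygons, proof of Theorem 3.2.3)] -/
theorem exists_insertion (hω : ω ∈ triSL n) (hT : IsTopLeft ω n j) (h0 : 0 < j) (hj : j < n)
    (hlam : lam ∈ loopSL (m - 1)) (hm : 3 ≤ m) :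
    ∃ (s : ℕ) (c : Bool) (r₀ : ℕ) (d₀ : Bool) (Λ : List (Site 2)), s < n ∧ r₀ < m ∧ Λ.length = m + 4 ∧
      splice s Λ ω ∈ triSL (n + (m + 4)) ∧ polyDecode (pathOf c m Λ) r₀ d₀ = lam := by
  have hS := (mem_loopSL.1 hlam).1
  have hlm : lam.length = m := by rw [length_of_mem_triSL hS]; omega
  obtain ⟨o, pS, s, hs, hst, hen⟩ := exists_orientation hω hT h0 hj
  obtain ⟨r, hB⟩ := exists_isBotLeft lam (show 0 < m by omega)
  obtain ⟨qV, e, he, hβ⟩ := exists_corner hlam hm hB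
  set p := ω.getD j 0 with hp
  set q := lam.getD r 0 with hq
  set τ : Site 2 := pt p (qaOf qV) 2 - q with hτ
  have hqτ : q + τ = pt p (qaOf qV) 2 := by rw [hτ]; abel
  have hβτ : lam.getD e 0 + τ = pt p (qaOf qV + (bOff qV).1) (2 + (bOff qV).2) := by
    rw [hβ, pt_add, hqτ, pt_pt]
  obtain ⟨⟨r₁, hr₁, d₁, hu₁, hv₁⟩, ⟨r₂, hr₂, d₂, hu₂, hv₂⟩⟩ := exists_polyPath_ends hlm hB.lt he τ
  rw [hqτ] at hu₁ hv₂
  rw [hβτ] at hv₁ hu₂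
  have hg := gad_valid o pS qV
  rw [← gad_st o pS qV] at hst
  rw [← gad_en o pS qV] at hen
  rw [← gad_qa o pS qV] at hqτ
  rcases gad_uv o pS qV with ⟨hu, hv⟩ | ⟨hu, hv⟩
  · obtain ⟨c, r₀, d₀, Λ, h⟩ := insertion_of_gadget (gad o pS qV) hg (gad_c1 o pS qV) hω hT (by omega) hst hen
      hlam hlm hB hqτ hr₁ (d₀ := d₁) (by rw [hu]; exact hu₁) (by rw [hv]; exact hv₁)
    exact ⟨s, c, r₀, d₀, Λ, hs, h⟩
  · obtain ⟨c, r₀, d₀, Λ, h⟩ := insertion_of_gadget (gad o pS qV) hg (gad_c1 o pS qV) hω hT (by omega) hst hen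
      hlam hlm hB hqτ hr₂ (d₀ := d₂) (by rw [hu]; exact hu₂) (by rw [hv]; exact hv₂)
    exact ⟨s, c, r₀, d₀, Λ, hs, h⟩

end PolygonInsertion

end Literature.Probability.RandomPlanarGeometry.SAW
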